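import Literature.Combinatorics.SimpleGraph.HamiltonianGadgetSubstitution
import Mathlib.Combinatorics.SimpleGraph.Maps
import HarnessLib

/-!
# Gadget substitution for Hamiltonian-path counts, III: transport of gadgets along an embedding

Continuation of `HamiltonianGadgetSubstitution.lean`. A gadget is designed and certified ONCE on a
small vertex type `τ` (a "template": its exclusivity `Exclusive` and its census `coverCount` are
finite facts about an explicit small graph) and then placed many times in a large graph on `β`
along injections `φ : τ ↪ β` (Garey–Johnson 1979, §3.2.2: "each … is replaced by a copy of the
gadget"). This file proves that the notions of the framework are invariant under such a
relabelling: strands (`isStrand_map_iff`, and every strand of the image is an image,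
`exists_eq_map_of_isStrand`), ports and slots (`ports_map`, `slotOf_map_iff`),
**exclusivity** (`Exclusive.map`: an exclusive template stays exclusive when embedded) and **the
census** (`coverCount_map`, through the push-forward of covers `pushFamily`, which is a bijection
between the covers of the template and the covers of its image, `isCover_pushFamily`,
`exists_eq_pushFamily_of_isCover`, `pushFamily_injOn`).

## References

* M. R. Garey, D. S. Johnson, *Computers and Intractability*, Freeman 1979, §3.2.2.
-/

namespace Literature.Combinatorics.SimpleGraph

open scoped Classical

variable {τ β : Type*} (φ : τ ↪ β)

/-! ### Adjacency, chains and strands under an embedding -/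

/-- Adjacency of images in the pushed-forward graph. [folklore] -/
theorem map_adj_iff {G : _root_.SimpleGraph τ} {a b : τ} : (G.map φ).Adj (φ a) (φ b) ↔ G.Adj a b := by
  rw [SimpleGraph.map_adj]
  constructor
  · rintro ⟨a', b', h, ha, hb⟩
    rw [φ.injective ha, φ.injective hb] at h
    exact h
  · exact fun h => ⟨a, b, h, rfl, rfl⟩

/-- A vertex of the pushed-forward graph with a neighbour is an image. [folklore] -/
theorem exists_eq_of_map_adj {G : _root_.SimpleGraph τ} {u v : β} (h : (G.map φ).Adj u v) :
    (∃ a, φ a = u) ∧ ∃ b, φ b = v := by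
  rw [SimpleGraph.map_adj] at h
  obtain ⟨a, b, -, ha, hb⟩ := h
  exact ⟨⟨a, ha⟩, ⟨b, hb⟩⟩

/-- Chains of images are chains. [folklore] -/
theorem isChain_map_iff {G : _root_.SimpleGraph τ} {l : List τ} :
    List.IsChain (G.map φ).Adj (l.map φ) ↔ List.IsChain G.Adj l := by
  rw [List.isChain_map]
  constructor
  · exact fun h => h.imp fun a b hab => (map_adj_iff φ).1 hab
  · exact fun h => h.imp fun a b hab => (map_adj_iff φ).2 hab

/-- A list inside the range of the embedding is the image of a list. [folklore] -/
theorem exists_eq_map_of_forall_mem_range : ∀ {ys : List β}, (∀ y ∈ ys, ∃ x, φ x = y) →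
    ∃ xs : List τ, ys = xs.map φ
  | [], _ => ⟨[], rfl⟩
  | y :: ys, h => by
    obtain ⟨x, rfl⟩ := h y List.mem_cons_self
    obtain ⟨xs, rfl⟩ := exists_eq_map_of_forall_mem_range fun z hz => h z (List.mem_cons_of_mem _ hz)
    exact ⟨x :: xs, rfl⟩

/-- **Strands are invariant under the embedding.** [folklore] -/
theorem isStrand_map_iff {G : _root_.SimpleGraph τ} {VX : Finset τ} {a b : τ} {xs : List τ} :
    IsStrand (G.map φ) (VX.map φ) (φ a) (φ b) (xs.map φ) ↔ IsStrand G VX a b xs := by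
  unfold IsStrand
  rw [List.nodup_map_iff φ.injective, show φ a :: (xs.map φ ++ [φ b]) = (a :: (xs ++ [b])).map φ by simp,
    isChain_map_iff]
  simp only [ne_eq, List.map_eq_nil_iff, List.forall_mem_map, Finset.mem_map' φ]

/-- **Every strand of the embedded gadget between image ports is the image of a strand.**
[folklore] -/
theorem exists_eq_map_of_isStrand {G : _root_.SimpleGraph τ} {VX : Finset τ} {a b : τ} {ys : List β}
    (h : IsStrand (G.map φ) (VX.map φ) (φ a) (φ b) ys) : ∃ xs : List τ, ys = xs.map φ ∧ IsStrand G VX a b xs := by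
  obtain ⟨xs, rfl⟩ := exists_eq_map_of_forall_mem_range φ (ys := ys) fun y hy => by
    obtain ⟨x, -, hx⟩ := Finset.mem_map.1 (h.2.1 y hy)
    exact ⟨x, hx⟩
  exact ⟨xs, rfl, (isStrand_map_iff φ).1 h⟩

/-! ### Ports and slots under an embedding -/

section ports

variable [DecidableEq τ] [DecidableEq β]

/-- The ports of the embedded slots are the images of the ports. [folklore] -/
theorem ports_map (S : Finset (τ × τ)) : ports (S.map (φ.prodMap φ)) = (ports S).map φ := by
  ext y
  rw [mem_ports_iff, Finset.mem_map]
  constructor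
  · rintro ⟨e, he, hy⟩
    rw [Finset.mem_map] at he
    obtain ⟨⟨a, b⟩, hab, rfl⟩ := he
    rcases hy with rfl | rfl
    · exact ⟨a, mem_ports_iff.2 ⟨(a, b), hab, Or.inl rfl⟩, rfl⟩
    · exact ⟨b, mem_ports_iff.2 ⟨(a, b), hab, Or.inr rfl⟩, rfl⟩
  · rintro ⟨x, hx, rfl⟩
    obtain ⟨e, he, hxe⟩ := mem_ports_iff.1 hx
    refine ⟨(φ e.1, φ e.2), Finset.mem_map.2 ⟨e, he, rfl⟩, ?_⟩
    rcases hxe with rfl | rfl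
    · exact Or.inl rfl
    · exact Or.inr rfl

/-- A port of the embedded slots is an image. [folklore] -/
theorem exists_eq_of_mem_ports_map {S : Finset (τ × τ)} {y : β} (hy : y ∈ ports (S.map (φ.prodMap φ))) :
    ∃ x ∈ ports S, φ x = y := by
  rw [ports_map] at hy
  simpa using hy

end ports

/-- Membership of an image pair in the embedded slots. [folklore] -/
theorem mem_map_prodMap_iff {S : Finset (τ × τ)} {a b : τ} : (φ a, φ b) ∈ S.map (φ.prodMap φ) ↔ (a, b) ∈ S := by
  rw [Finset.mem_map]
  constructor
  · rintro ⟨⟨a', b'⟩, h, heq⟩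
    simp only [Function.Embedding.prodMap, Function.Embedding.coeFn_mk, Prod.map_apply, Prod.mk.injEq] at heq
    rw [← φ.injective heq.1, ← φ.injective heq.2]
    exact h
  · exact fun h => ⟨(a, b), h, rfl⟩

/-- **Slots are invariant under the embedding.** [folklore] -/
theorem slotOf_map_iff {S : Finset (τ × τ)} {a b : τ} : slotOf (S.map (φ.prodMap φ)) (φ a) (φ b) ↔ slotOf S a b := by
  unfold slotOf
  rw [mem_map_prodMap_iff, mem_map_prodMap_iff]

/-! ### Exclusivity is preserved by the embedding -/

/-- **An exclusive template stays exclusive when embedded**: a cover of the embedded gadget by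
port-to-port strands pulls back to a cover of the template (ports and inner vertices lie in the
range of the embedding), to which the template's exclusivity applies.
[cite: GareyJohnson1979, §3.2.2 (local replacement by copies of a gadget)] -/
theorem Exclusive.map [DecidableEq τ] [DecidableEq β] {G : _root_.SimpleGraph τ} {VX : Finset τ} {S : Finset (τ × τ)} (hE : Exclusive G VX S) :
    Exclusive (G.map φ) (VX.map φ) (S.map (φ.prodMap φ)) := by
  intro T' h1 h2 h3 h4
  -- every triple of `T'` is the image of a triple of the template
  have hpre : ∀ t ∈ T', ∃ a xs b, (φ a, xs.map φ, φ b) = t ∧ IsStrand G VX a b xs := by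
    intro t ht
    obtain ⟨hp1, hp2, hst⟩ := h1 t ht
    obtain ⟨a, -, ha⟩ := exists_eq_of_mem_ports_map φ hp1
    obtain ⟨b, -, hb⟩ := exists_eq_of_mem_ports_map φ hp2
    rw [← ha, ← hb] at hst
    obtain ⟨xs, hxs, hs⟩ := exists_eq_map_of_isStrand φ hst
    refine ⟨a, xs, b, ?_, hs⟩
    obtain ⟨t1, t2, t3⟩ := t
    simp only at ha hb hxs
    rw [ha, hb, hxs]
  -- the pulled-back family
  set T : Set (τ × List τ × τ) := {σ | (φ σ.1, σ.2.1.map φ, φ σ.2.2) ∈ T'} with hT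
  have key : ∀ σ ∈ T, slotOf S σ.1 σ.2.2 := by
    refine hE T (fun σ hσ => ?_) (fun σ hσ σ' hσ' hne => ?_) (fun σ hσ => ?_) (fun x hx => ?_)
    · obtain ⟨hp1, hp2, hst⟩ := h1 _ hσ
      refine ⟨?_, ?_, (isStrand_map_iff φ).1 hst⟩
      · obtain ⟨a, ha, heq⟩ := exists_eq_of_mem_ports_map φ hp1
        rwa [← φ.injective heq]
      · obtain ⟨b, hb, heq⟩ := exists_eq_of_mem_ports_map φ hp2
        rwa [← φ.injective heq]
    · have hne' : (φ σ.1, σ.2.1.map φ, φ σ.2.2) ≠ (φ σ'.1, σ'.2.1.map φ, φ σ'.2.2) := by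
        intro heq
        simp only [Prod.mk.injEq] at heq
        obtain ⟨h1', h2', h3'⟩ := heq
        apply hne
        obtain ⟨a, xs, b⟩ := σ
        obtain ⟨a', xs', b'⟩ := σ'
        simp only at h1' h2' h3'
        rw [φ.injective h1', (List.map_injective_iff.2 φ.injective) h2', φ.injective h3']
      obtain ⟨d1, d2, d3, d4, d5⟩ := h2 _ hσ _ hσ' hne'
      refine ⟨fun h => d1 (by rw [h]), fun h => d2 (by rw [h]), fun h => d3 (by rw [h]), fun h => d4 (by rw [h]),
        fun x hx hx' => d5 (List.mem_map_of_mem hx) (List.mem_map_of_mem hx')⟩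
    · intro heq
      exact h3 _ hσ (by simp only; rw [heq])
    · obtain ⟨t, ht, hxt⟩ := h4 (φ x) (Finset.mem_map_of_mem φ hx)
      obtain ⟨a, xs, b, rfl, -⟩ := hpre t ht
      refine ⟨(a, xs, b), ht, ?_⟩
      simpa [List.mem_map, φ.injective.eq_iff] using hxt
  -- conclude for the given triple
  intro t ht
  obtain ⟨a, xs, b, rfl, -⟩ := hpre t ht
  exact (slotOf_map_iff φ).2 (key (a, xs, b) ht)

/-! ### The census is preserved by the embedding -/

section cover

variable {G : _root_.SimpleGraph τ} {VX : Finset τ} {U : Finset (τ × τ)}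

/-- **Push-forward of a family of strands** along the embedding: on an image pair the image of
the strand, the empty list elsewhere. [folklore] -/
noncomputable def pushFamily (f : τ × τ → List τ) (e' : β × β) : List β :=
  if h : ∃ e : τ × τ, (φ e.1, φ e.2) = e' then (f h.choose).map φ else []

/-- The push-forward on an image pair. [folklore] -/
theorem pushFamily_apply (f : τ × τ → List τ) (e : τ × τ) : pushFamily φ f (φ e.1, φ e.2) = (f e).map φ := by
  unfold pushFamily
  have h : ∃ e₀ : τ × τ, (φ e₀.1, φ e₀.2) = (φ e.1, φ e.2) := ⟨e, rfl⟩
  rw [dif_pos h]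
  congr 2
  obtain ⟨h1, h2⟩ := Prod.mk.inj h.choose_spec
  exact Prod.ext (φ.injective h1) (φ.injective h2)

/-- The push-forward vanishes off the image pairs. [folklore] -/
theorem pushFamily_of_not (f : τ × τ → List τ) {e' : β × β} (h : ¬ ∃ e : τ × τ, (φ e.1, φ e.2) = e') :
    pushFamily φ f e' = [] := by
  rw [pushFamily, dif_neg h]

/-- Elements of the embedded slot set are image pairs. [folklore] -/
theorem exists_eq_of_mem_map_prodMap {e' : β × β} (he' : e' ∈ U.map (φ.prodMap φ)) :
    ∃ e ∈ U, (φ e.1, φ e.2) = e' := by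
  obtain ⟨e, he, rfl⟩ := Finset.mem_map.1 he'
  exact ⟨e, he, rfl⟩

/-- **The push-forward of a cover is a cover of the embedded gadget.** [folklore] -/
theorem isCover_pushFamily {f : τ × τ → List τ} (hf : IsCover G VX U f) :
    IsCover (G.map φ) (VX.map φ) (U.map (φ.prodMap φ)) (pushFamily φ f) := by
  refine ⟨fun e' he' => ?_, fun e' he' => ?_, fun e₁ he₁ e₂ he₂ hne => ?_, fun y hy => ?_⟩
  · obtain ⟨e, he, rfl⟩ := exists_eq_of_mem_map_prodMap φ he'
    rw [pushFamily_apply]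
    exact (isStrand_map_iff φ).2 (hf.1 e he)
  · by_cases h : ∃ e : τ × τ, (φ e.1, φ e.2) = e'
    · obtain ⟨e, rfl⟩ := h
      rw [pushFamily_apply, hf.2.1 e (fun he => he' ((mem_map_prodMap_iff φ).2 he)), List.map_nil]
    · exact pushFamily_of_not φ f h
  · obtain ⟨a₁, ha₁, rfl⟩ := exists_eq_of_mem_map_prodMap φ he₁
    obtain ⟨a₂, ha₂, rfl⟩ := exists_eq_of_mem_map_prodMap φ he₂
    rw [pushFamily_apply, pushFamily_apply]
    intro y hy₁ hy₂
    obtain ⟨x₁, hx₁, rfl⟩ := List.mem_map.1 hy₁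
    obtain ⟨x₂, hx₂, hx⟩ := List.mem_map.1 hy₂
    rw [φ.injective hx] at hx₂
    exact hf.2.2.1 a₁ ha₁ a₂ ha₂ (fun h => hne (by rw [h])) hx₁ hx₂
  · obtain ⟨x, hx, rfl⟩ := Finset.mem_map.1 hy
    obtain ⟨e, he, hxe⟩ := hf.2.2.2 x hx
    exact ⟨(φ e.1, φ e.2), (mem_map_prodMap_iff φ).2 he, by rw [pushFamily_apply]; exact List.mem_map_of_mem hxe⟩

/-- **Every cover of the embedded gadget is the push-forward of a cover of the template.**
[folklore] -/
theorem exists_eq_pushFamily_of_isCover {f' : β × β → List β}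
    (hf' : IsCover (G.map φ) (VX.map φ) (U.map (φ.prodMap φ)) f') : ∃ f, IsCover G VX U f ∧ pushFamily φ f = f' := by
  -- pull back strand by strand
  have hpull : ∀ e ∈ U, ∃ xs, f' (φ e.1, φ e.2) = xs.map φ ∧ IsStrand G VX e.1 e.2 xs := fun e he =>
    exists_eq_map_of_isStrand φ (hf'.1 _ ((mem_map_prodMap_iff φ).2 he))
  choose! g hg using hpull
  refine ⟨fun e => if e ∈ U then g e else [], ⟨fun e he => ?_, fun e he => if_neg he, fun e₁ he₁ e₂ he₂ hne => ?_,
    fun x hx => ?_⟩, ?_⟩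
  · dsimp only
    rw [if_pos he]; exact (hg e he).2
  · dsimp only
    rw [if_pos he₁, if_pos he₂]
    intro x hx₁ hx₂
    have hne' : (φ e₁.1, φ e₁.2) ≠ (φ e₂.1, φ e₂.2) := fun h => hne (by
      simp only [Prod.mk.injEq] at h
      exact Prod.ext (φ.injective h.1) (φ.injective h.2))
    have h1 : φ x ∈ f' (φ e₁.1, φ e₁.2) := by rw [(hg e₁ he₁).1]; exact List.mem_map_of_mem hx₁
    have h2 : φ x ∈ f' (φ e₂.1, φ e₂.2) := by rw [(hg e₂ he₂).1]; exact List.mem_map_of_mem hx₂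
    exact hf'.2.2.1 _ ((mem_map_prodMap_iff φ).2 he₁) _ ((mem_map_prodMap_iff φ).2 he₂) hne' h1 h2
  · obtain ⟨e', he', hxe'⟩ := hf'.2.2.2 (φ x) (Finset.mem_map_of_mem φ hx)
    obtain ⟨e, he, rfl⟩ := exists_eq_of_mem_map_prodMap φ he'
    refine ⟨e, he, ?_⟩
    dsimp only
    rw [if_pos he]
    rw [(hg e he).1] at hxe'
    obtain ⟨x', hx', hxx⟩ := List.mem_map.1 hxe'
    rwa [← φ.injective hxx]
  · funext e'
    by_cases h : ∃ e : τ × τ, (φ e.1, φ e.2) = e'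
    · obtain ⟨e, rfl⟩ := h
      rw [pushFamily_apply]
      by_cases he : e ∈ U
      · rw [if_pos he, (hg e he).1]
      · rw [if_neg he, List.map_nil, hf'.2.1 _ (fun he' => he ((mem_map_prodMap_iff φ).1 he'))]
    · rw [pushFamily_of_not φ _ h, hf'.2.1 _ (fun he' => h ?_)]
      obtain ⟨e, -, rfl⟩ := exists_eq_of_mem_map_prodMap φ he'
      exact ⟨e, rfl⟩

/-- The push-forward is injective on covers. [folklore] -/
theorem pushFamily_injOn : Set.InjOn (pushFamily φ) (coverSet G VX U) := by
  intro f hf f' hf' heq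
  funext e
  by_cases he : e ∈ U
  · have := congrFun heq (φ e.1, φ e.2)
    rw [pushFamily_apply, pushFamily_apply] at this
    exact (List.map_injective_iff.2 φ.injective) this
  · rw [hf.2.1 e he, hf'.2.1 e he]

/-- **The census of a gadget is invariant under the embedding.**
[cite: GareyJohnson1979, §3.2.2 (local replacement by copies of a gadget)] -/
theorem coverCount_map : coverCount (G.map φ) (VX.map φ) (U.map (φ.prodMap φ)) = coverCount G VX U := by
  have himage : coverSet (G.map φ) (VX.map φ) (U.map (φ.prodMap φ)) = pushFamily φ '' coverSet G VX U := by
    ext f'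
    constructor
    · intro hf'
      obtain ⟨f, hf, rfl⟩ := exists_eq_pushFamily_of_isCover φ hf'
      exact ⟨f, hf, rfl⟩
    · rintro ⟨f, hf, rfl⟩
      exact isCover_pushFamily φ hf
  rw [coverCount, coverCount, himage, (pushFamily_injOn φ).ncard_image]

end cover

end Literature.Combinatorics.SimpleGraph
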